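import Summits.AtomisticToContinuum.FouriersLaw.Theorems.HiddenChargeMazurStaticKuboStubLasotaYorkeCoupling

/-!
# `HiddenChargeMazur.StaticKubo`, line `birth`, stub `stub_lasotaYorke` — aux 4: high-energy pairs and the current

Helper file (`--supports stmt-AtomisticToContinuum-13510`, crux decl `HiddenChargeMazur.StaticKubo`,
skeleton `Cruxes/StaticKubo/Lines/birth.lean` rev 4, stub S5 `stub_lasotaYorke` of the lead).

Consequences of the integrated coupling estimate (aux 3) for the pinned chain at equal temperatures `T`:

* `norm_solMap_sub_le_of_twoPoint` — from the two-point Grönwall bound (stub S1, taken as a hypothesis for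
  this chain) to `‖X_t^x − X_t^y‖ ≤ ‖x−y‖ e^{Λ}` with the unit-window rate `Λ` (`t ≤ 1`);
* `abs_totalBondCurrent_sub_le_exp` — the total current has a pair bound of exponential class `ϑ`
  (`(1+h)² ≤ 2(1 + 4/ϑ²)e^{ϑh}`);
* `current_forecast_pair_bound` — clause (b) of the stub, raw form: `|P_tJ(x) − P_tJ(y)| ≤ ‖x−y‖ √G · C_b e^{2ϑγT}(e^{ϑHx} + e^{ϑHy})`;
* `high_forecast_pair_bound` — the HIGH-ENERGY step of clause (a), raw form: given the high-energy decay with a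
  rate (stub S3 at `2θ₁`, a hypothesis here) at both starts,
  `|P_1φ(x) − P_1φ(y)| ≤ ‖x−y‖ √G (K √C₃ (e^{θ₁Hx − c₃Hx^{3/4}/2} + e^{θ₁Hy − c₃Hy^{3/4}/2}) + M e^{2ϑγT}(e^{ϑHx} + e^{ϑHy}))`.

References: folklore. Nothing here closes the item.
-/

noncomputable section

open MeasureTheory Filter Topology Set Metric
open scoped NNReal ENNReal
open Literature.MathematicalPhysics.KineticTheory.HeatConduction Literature.MathematicalPhysics.KineticTheory
open Literature.Probability.Process OscillatorChain
open Summit.AtomisticToContinuum.FouriersLaw.Theorems.OddSectorIrreversibility.Corrector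

namespace Summit.AtomisticToContinuum.FouriersLaw.Cruxes.StaticKubo.Birth.Stubs

variable {N : ℕ}

/-- `(1 + h)² ≤ 2(1 + 4/ϑ²) e^{ϑh}` for `h ≥ 0`, `ϑ > 0`. [folklore] -/
theorem one_add_sq_le_exp' {h ϑ : ℝ} (hh : 0 ≤ h) (hϑ : 0 < ϑ) :
    (1 + h) ^ 2 ≤ 2 * (1 + 4 / ϑ ^ 2) * Real.exp (ϑ * h) := by
  have h1 : 1 ≤ Real.exp (ϑ * h) := Real.one_le_exp (by positivity)
  -- `(ϑh/2)² ≤ e^{ϑh}` from `1 + ϑh/2 ≤ e^{ϑh/2}`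
  have h2 : (ϑ * h / 2) ^ 2 ≤ Real.exp (ϑ * h) := by
    have h3 : ϑ * h / 2 ≤ Real.exp (ϑ * h / 2) := by
      have := Real.add_one_le_exp (ϑ * h / 2); linarith
    have h4 : 0 ≤ ϑ * h / 2 := by positivity
    calc (ϑ * h / 2) ^ 2 ≤ Real.exp (ϑ * h / 2) ^ 2 := pow_le_pow_left₀ h4 h3 2
      _ = Real.exp (ϑ * h) := by rw [← Real.exp_nat_mul]; push_cast; ring_nf
  have h5 : h ^ 2 ≤ 4 / ϑ ^ 2 * Real.exp (ϑ * h) := by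
    rw [div_mul_eq_mul_div, le_div_iff₀ (by positivity)]
    nlinarith
  nlinarith [sq_nonneg (1 - h)]

/-- `√(a e^u) = √a e^{u/2}` for `a ≥ 0`. [folklore] -/
theorem sqrt_mul_exp {a u : ℝ} (ha : 0 ≤ a) : Real.sqrt (a * Real.exp u) = Real.sqrt a * Real.exp (u / 2) := by
  have hsq_exp : Real.sqrt (Real.exp u) = Real.exp (u / 2) := by
    rw [Real.sqrt_eq_iff_mul_self_eq_of_pos (Real.exp_pos _), ← Real.exp_add]; ring_nf
  rw [Real.sqrt_mul ha, hsq_exp]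

section Flow

variable {ω₂ lam β γ : ℝ} (hω : 0 < ω₂) (hl : 0 ≤ lam) (hβ : 0 ≤ β) (hγ : 0 ≤ γ) (hN : 0 < N)
  {T : ℝ} (hT : 0 < T)
include hω hl hβ hγ hN hT

-- the flow is a limit of Picard iterations: never let the unifier unfold it (heartbeats)
attribute [local irreducible] OscillatorChain.chainFlow

omit hN hT in
/-- **From the two-point Grönwall bound to the unit-window coupling bound.** If the pathwise solutions driven by
any continuous noise path satisfy `‖z_x(t) − z_y(t)‖ ≤ ‖x−y‖ exp(∫₀ᵗ C₀(1 + √H(z_x) + √H(z_y)))` (`C₀ ≥ 0`), then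
for `t ≤ 1` the solution maps driven by the Brownian pair satisfy `‖X_t^x − X_t^y‖ ≤ ‖x−y‖ e^{Λ}` with the
rate `Λ = ∫₀¹ C₀(1 + √H(X_s^x) + √H(X_s^y)) ds`. [folklore] -/
theorem norm_solMap_sub_le_of_twoPoint {C₀ : ℝ} (hC : 0 ≤ C₀)
    (hS1 : ∀ η : ℝ → Fin N → ℝ, Continuous η → ∀ (x y : PhaseSpace N) (t : ℝ), 0 ≤ t →
      ‖(pinnedChain ω₂ lam β γ).chainFlow N x η t - (pinnedChain ω₂ lam β γ).chainFlow N y η t‖ ≤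
        ‖x - y‖ * Real.exp (∫ s in (0 : ℝ)..t, C₀ * (1 +
          Real.sqrt ((pinnedChain ω₂ lam β γ).hamiltonian N ((pinnedChain ω₂ lam β γ).chainFlow N x η s)) +
          Real.sqrt ((pinnedChain ω₂ lam β γ).hamiltonian N ((pinnedChain ω₂ lam β γ).chainFlow N y η s)))))
    (t : ℝ≥0) (ht : (t : ℝ) ≤ 1) (x y : PhaseSpace N) (ω : WienerPair) :
    ‖(pinnedChain ω₂ lam β γ).solMap N T T t x (pairPath ω) - (pinnedChain ω₂ lam β γ).solMap N T T t y (pairPath ω)‖ ≤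
      ‖x - y‖ * Real.exp (∫ s in (0 : ℝ)..1, C₀ * (1 +
        Real.sqrt ((pinnedChain ω₂ lam β γ).hamiltonian N ((pinnedChain ω₂ lam β γ).solMap N T T s x (pairPath ω))) +
        Real.sqrt ((pinnedChain ω₂ lam β γ).hamiltonian N ((pinnedChain ω₂ lam β γ).solMap N T T s y (pairPath ω))))) := by
  set P := pinnedChain ω₂ lam β γ with hP
  set η : ℝ → Fin N → ℝ := chainNoise N (Real.sqrt (2 * P.γ * T)) (Real.sqrt (2 * P.γ * T)) (pairPath ω) with hη
  have hηc : Continuous η := continuous_chainNoise _ _ _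
  have h := hS1 η hηc x y t t.coe_nonneg
  -- the solution map is the pathwise flow driven by `η`
  have hX : ∀ (z : PhaseSpace N) (s : ℝ), P.solMap N T T s z (pairPath ω) = P.chainFlow N z η s := fun z s => rfl
  simp_rw [hX]
  refine h.trans (mul_le_mul_of_nonneg_left (Real.exp_le_exp.2 ?_) (norm_nonneg _))
  -- monotonicity of the integral of a nonnegative continuous integrand in the upper limit
  set g : ℝ → ℝ := fun s => C₀ * (1 + Real.sqrt (P.hamiltonian N (P.chainFlow N x η s)) +
    Real.sqrt (P.hamiltonian N (P.chainFlow N y η s))) with hg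
  have hgc : Continuous g := by
    have hx := pinnedChain_continuous_chainFlow hω hl hβ hγ N x hηc
    have hy := pinnedChain_continuous_chainFlow hω hl hβ hγ N y hηc
    have hH := pinnedChain_continuous_hamiltonian ω₂ lam β γ N
    simp only [hg]
    fun_prop
  have hg0 : ∀ s, 0 ≤ g s := fun s => by
    simp only [hg]
    have := Real.sqrt_nonneg (P.hamiltonian N (P.chainFlow N x η s))
    have := Real.sqrt_nonneg (P.hamiltonian N (P.chainFlow N y η s))
    positivity
  exact intervalIntegral.integral_mono_interval le_rfl t.coe_nonneg ht (Eventually.of_forall hg0)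
    (hgc.intervalIntegrable 0 1)

omit hγ hN hT in
/-- **The total current has a pair bound of exponential class**: for `ϑ > 0` and `‖z − z'‖ ≤ 1`,
`|J z − J z'| ≤ K_J ‖z − z'‖ (e^{ϑHz} + e^{ϑHz'})` with `K_J = N(5+13β)e^{2K_H} · 2(1 + 4/ϑ²)`. [folklore] -/
theorem abs_totalBondCurrent_sub_le_exp {ϑ : ℝ} (hϑ : 0 < ϑ) (z z' : PhaseSpace N) (hzz : ‖z - z'‖ ≤ 1) :
    |(∑ i : Fin N, (pinnedChain ω₂ lam β γ).bondCurrent N i z) - ∑ i : Fin N, (pinnedChain ω₂ lam β γ).bondCurrent N i z'| ≤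
      (N * (5 + 13 * β) * Real.exp (2 * (N * (ω₂ / 2 + 3 + lam / ω₂ + N ^ 2 * (3 + β)) + N / 2 + 1)) *
        (2 * (1 + 4 / ϑ ^ 2))) * ‖z - z'‖ *
        (Real.exp (ϑ * (pinnedChain ω₂ lam β γ).hamiltonian N z) + Real.exp (ϑ * (pinnedChain ω₂ lam β γ).hamiltonian N z')) := by
  have h := abs_totalBondCurrent_sub_le hω hl hβ γ N z z' hzz
  have hHz : 0 ≤ (pinnedChain ω₂ lam β γ).hamiltonian N z := pinnedChain_hamiltonian_nonneg hω.le hl hβ γ N z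
  have h1 := one_add_sq_le_exp' hHz hϑ
  have h2 : 0 ≤ Real.exp (ϑ * (pinnedChain ω₂ lam β γ).hamiltonian N z') := (Real.exp_pos _).le
  have hc : 0 ≤ N * (5 + 13 * β) * Real.exp (2 * (N * (ω₂ / 2 + 3 + lam / ω₂ + N ^ 2 * (3 + β)) + N / 2 + 1)) := by
    positivity
  refine h.trans ?_
  calc N * (5 + 13 * β) * Real.exp (2 * (N * (ω₂ / 2 + 3 + lam / ω₂ + N ^ 2 * (3 + β)) + N / 2 + 1)) *
        (1 + (pinnedChain ω₂ lam β γ).hamiltonian N z) ^ 2 * ‖z - z'‖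
      ≤ N * (5 + 13 * β) * Real.exp (2 * (N * (ω₂ / 2 + 3 + lam / ω₂ + N ^ 2 * (3 + β)) + N / 2 + 1)) *
        (2 * (1 + 4 / ϑ ^ 2) * Real.exp (ϑ * (pinnedChain ω₂ lam β γ).hamiltonian N z)) * ‖z - z'‖ := by
        gcongr
    _ ≤ _ := by
        have : 0 ≤ N * (5 + 13 * β) * Real.exp (2 * (N * (ω₂ / 2 + 3 + lam / ω₂ + N ^ 2 * (3 + β)) + N / 2 + 1)) *
            (2 * (1 + 4 / ϑ ^ 2)) * ‖z - z'‖ * Real.exp (ϑ * (pinnedChain ω₂ lam β γ).hamiltonian N z') := by positivity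
        nlinarith

/-- **Clause (b), raw form: the forecasts of the total current.** With the unit-window coupling bound (as in
`norm_solMap_sub_le_of_twoPoint`) and `0 < ϑ < 1/(2T)`, there is `C_b ≥ 0` such that for `t ≤ 1` and all `x, y`,
`|P_tJ(x) − P_tJ(y)| ≤ ‖x−y‖ √G (C_b e^{2ϑγT}(e^{ϑHx} + e^{ϑHy}))`, `G` the rate-moment bound of aux 2/3. [folklore] -/
theorem current_forecast_pair_bound {C₀ : ℝ} (hC : 0 ≤ C₀)
    (hD : ∀ (t : ℝ≥0), (t : ℝ) ≤ 1 → ∀ (x y : PhaseSpace N) (ω : WienerPair),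
      ‖(pinnedChain ω₂ lam β γ).solMap N T T t x (pairPath ω) - (pinnedChain ω₂ lam β γ).solMap N T T t y (pairPath ω)‖ ≤
      ‖x - y‖ * Real.exp (∫ s in (0 : ℝ)..1, C₀ * (1 +
        Real.sqrt ((pinnedChain ω₂ lam β γ).hamiltonian N ((pinnedChain ω₂ lam β γ).solMap N T T s x (pairPath ω))) +
        Real.sqrt ((pinnedChain ω₂ lam β γ).hamiltonian N ((pinnedChain ω₂ lam β γ).solMap N T T s y (pairPath ω))))))
    {ϑ : ℝ} (hϑ : 0 < ϑ) (hϑT : ϑ < 1 / (2 * T)) :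
    ∃ Cb : ℝ, 0 ≤ Cb ∧ ∀ (t : ℝ≥0), (t : ℝ) ≤ 1 → ∀ x y : PhaseSpace N,
      |(∫ z, (∑ i : Fin N, (pinnedChain ω₂ lam β γ).bondCurrent N i z) ∂((pinnedChain ω₂ lam β γ).transitionKernel N T T t x)) -
          ∫ z, (∑ i : Fin N, (pinnedChain ω₂ lam β γ).bondCurrent N i z) ∂((pinnedChain ω₂ lam β γ).transitionKernel N T T t y)| ≤
        ‖x - y‖ * (Real.sqrt (Real.exp (2 * C₀ + (8 * C₀ ^ 2 * T + γ) +
          (4 * C₀ ^ 2 * T + 1 / (4 * T)) * (Real.sqrt ((pinnedChain ω₂ lam β γ).hamiltonian N x) +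
            Real.sqrt ((pinnedChain ω₂ lam β γ).hamiltonian N y)))) *
          (Cb * (Real.exp (2 * ϑ * γ * T) * (Real.exp (ϑ * (pinnedChain ω₂ lam β γ).hamiltonian N x) +
            Real.exp (ϑ * (pinnedChain ω₂ lam β γ).hamiltonian N y))))) := by
  set P := pinnedChain ω₂ lam β γ with hP
  set H := P.hamiltonian N with hH
  set KJ : ℝ := N * (5 + 13 * β) * Real.exp (2 * (N * (ω₂ / 2 + 3 + lam / ω₂ + N ^ 2 * (3 + β)) + N / 2 + 1)) *
    (2 * (1 + 4 / ϑ ^ 2)) with hKJ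
  have hKJ0 : 0 ≤ KJ := by positivity
  obtain ⟨MJ, hMJ0, hMJ⟩ := abs_totalBondCurrent_le_exp hω.le hl hβ γ N hϑ
  refine ⟨KJ + MJ, by positivity, fun t ht x y => ?_⟩
  set J : PhaseSpace N → ℝ := fun z => ∑ i : Fin N, P.bondCurrent N i z with hJ
  have hJc : Continuous J := continuous_totalBondCurrent ω₂ lam β γ N
  have hϑT' : ϑ < 1 / T := hϑT.trans (by rw [div_lt_div_iff₀ (by positivity) hT]; linarith)
  have h2ϑ : 0 < 2 * ϑ := by positivity
  have h2ϑ' : 2 * ϑ < 1 / max T T := by rw [max_self, lt_div_iff₀ hT]; rw [lt_div_iff₀ (by positivity)] at hϑT; linarith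
  -- second moments of the weight `e^{ϑH}` at time `t` from (3.4)
  have hmom : ∀ z : PhaseSpace N, ∫⁻ ω, ENNReal.ofReal (Real.exp (2 * ϑ * H (P.solMap N T T t z (pairPath ω)))) ∂wienerPair ≤
      ENNReal.ofReal (Real.exp (2 * ϑ * γ * (T + T) * t) * Real.exp (2 * ϑ * H z)) := fun z =>
    pinnedChain_lintegral_exp_hamiltonian_solMap_le hω hl hβ hγ hN hT hT h2ϑ h2ϑ' t z
  have hcpl := lintegral_abs_sub_le_of_coupling hω hl hβ hγ hN hT hC t x y (hD t ht x y) (φ := J) hMJ0 hKJ0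
    (ϑ := ϑ) (θ₁ := ϑ) hMJ (fun z z' hzz => abs_totalBondCurrent_sub_le_exp hω hl hβ hϑ z z' hzz)
    (by positivity) (by positivity) (by positivity) (by positivity) (hmom x) (hmom y) (hmom x) (hmom y)
  have hfin := abs_forecast_sub_le_lintegral hω hl hβ hγ hN hT hJc hϑ hϑT' hMJ t x y
  refine hfin.trans ?_
  have hR0 : 0 ≤ ‖x - y‖ * (Real.sqrt (Real.exp (2 * C₀ + (8 * C₀ ^ 2 * T + γ) +
      (4 * C₀ ^ 2 * T + 1 / (4 * T)) * (Real.sqrt (H x) + Real.sqrt (H y)))) *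
      (KJ * (Real.sqrt (Real.exp (2 * ϑ * γ * (T + T) * t) * Real.exp (2 * ϑ * H x)) +
        Real.sqrt (Real.exp (2 * ϑ * γ * (T + T) * t) * Real.exp (2 * ϑ * H y))) +
      MJ * (Real.sqrt (Real.exp (2 * ϑ * γ * (T + T) * t) * Real.exp (2 * ϑ * H x)) +
        Real.sqrt (Real.exp (2 * ϑ * γ * (T + T) * t) * Real.exp (2 * ϑ * H y))))) := by positivity
  refine ((ENNReal.toReal_mono ENNReal.ofReal_ne_top hcpl).trans_eq (ENNReal.toReal_ofReal hR0)).trans ?_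
  -- simplify the square roots: `√(e^{a t} e^{2ϑH}) = e^{(at + 2ϑH)/2} ≤ e^{2ϑγT} e^{ϑH}` for `t ≤ 1`
  have hsq : ∀ z : PhaseSpace N, Real.sqrt (Real.exp (2 * ϑ * γ * (T + T) * t) * Real.exp (2 * ϑ * H z)) ≤
      Real.exp (2 * ϑ * γ * T) * Real.exp (ϑ * H z) := fun z => by
    rw [← Real.exp_add, ← one_mul (Real.exp (2 * ϑ * γ * (T + T) * ↑t + 2 * ϑ * H z)), sqrt_mul_exp zero_le_one,
      Real.sqrt_one, one_mul, ← Real.exp_add]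
    refine Real.exp_le_exp.2 ?_
    have ht0 : (0 : ℝ) ≤ t := t.coe_nonneg
    nlinarith [mul_nonneg (mul_nonneg (mul_nonneg h2ϑ.le hγ) hT.le) ht0,
      mul_nonneg (mul_nonneg (mul_nonneg h2ϑ.le hγ) hT.le) (sub_nonneg.2 ht)]
  have hsx := hsq x
  have hsy := hsq y
  have hG0 := Real.sqrt_nonneg (Real.exp (2 * C₀ + (8 * C₀ ^ 2 * T + γ) +
      (4 * C₀ ^ 2 * T + 1 / (4 * T)) * (Real.sqrt (H x) + Real.sqrt (H y))))
  have hxy := norm_nonneg (x - y)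
  have hstep : KJ * (Real.sqrt (Real.exp (2 * ϑ * γ * (T + T) * t) * Real.exp (2 * ϑ * H x)) +
        Real.sqrt (Real.exp (2 * ϑ * γ * (T + T) * t) * Real.exp (2 * ϑ * H y))) +
      MJ * (Real.sqrt (Real.exp (2 * ϑ * γ * (T + T) * t) * Real.exp (2 * ϑ * H x)) +
        Real.sqrt (Real.exp (2 * ϑ * γ * (T + T) * t) * Real.exp (2 * ϑ * H y))) ≤
      (KJ + MJ) * (Real.exp (2 * ϑ * γ * T) * (Real.exp (ϑ * H x) + Real.exp (ϑ * H y))) := by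
    have := add_le_add hsx hsy
    nlinarith [mul_nonneg hKJ0 (add_nonneg (Real.sqrt_nonneg (Real.exp (2 * ϑ * γ * (T + T) * t) * Real.exp (2 * ϑ * H x)))
      (Real.sqrt_nonneg (Real.exp (2 * ϑ * γ * (T + T) * t) * Real.exp (2 * ϑ * H y))))]
  exact mul_le_mul_of_nonneg_left (mul_le_mul_of_nonneg_left hstep hG0) hxy

/-- **The HIGH-ENERGY step of clause (a), raw form.** With the unit-window coupling bound, `0 < ϑ < θ₁ < 1/(2T)`,
the high-energy decay with a rate at exponent `2θ₁` above the level `E₀` (stub S3, a hypothesis here; `C₃ ≥ 0`),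
and an observable `φ` of value class `ϑ` with pair constant `K`: for `x, y` both above `E₀`,
`|P_1φ(x) − P_1φ(y)| ≤ ‖x−y‖ √G (K √C₃ (e^{θ₁Hx − c₃Hx^{3/4}/2} + e^{θ₁Hy − c₃Hy^{3/4}/2}) + M e^{2ϑγT}(e^{ϑHx} + e^{ϑHy}))`.
[folklore] -/
theorem high_forecast_pair_bound {C₀ : ℝ} (hC : 0 ≤ C₀)
    (hD : ∀ (t : ℝ≥0), (t : ℝ) ≤ 1 → ∀ (x y : PhaseSpace N) (ω : WienerPair),
      ‖(pinnedChain ω₂ lam β γ).solMap N T T t x (pairPath ω) - (pinnedChain ω₂ lam β γ).solMap N T T t y (pairPath ω)‖ ≤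
      ‖x - y‖ * Real.exp (∫ s in (0 : ℝ)..1, C₀ * (1 +
        Real.sqrt ((pinnedChain ω₂ lam β γ).hamiltonian N ((pinnedChain ω₂ lam β γ).solMap N T T s x (pairPath ω))) +
        Real.sqrt ((pinnedChain ω₂ lam β γ).hamiltonian N ((pinnedChain ω₂ lam β γ).solMap N T T s y (pairPath ω))))))
    {ϑ θ₁ : ℝ} (hϑ : 0 < ϑ) (hϑθ : ϑ < θ₁) (hθT : θ₁ < 1 / (2 * T)) {C₃ c₃ E₀ : ℝ} (hC₃ : 0 ≤ C₃)
    (hHED : ∀ z : PhaseSpace N, E₀ ≤ (pinnedChain ω₂ lam β γ).hamiltonian N z →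
      ∫⁻ ω, ENNReal.ofReal (Real.exp (2 * θ₁ * (pinnedChain ω₂ lam β γ).hamiltonian N
          ((pinnedChain ω₂ lam β γ).solMap N T T 1 z (pairPath ω)))) ∂wienerPair ≤
        ENNReal.ofReal (C₃ * Real.exp (2 * θ₁ * (pinnedChain ω₂ lam β γ).hamiltonian N z -
          c₃ * (pinnedChain ω₂ lam β γ).hamiltonian N z ^ (3 / 4 : ℝ))))
    {φ : PhaseSpace N → ℝ} (hφ : Continuous φ) {Mφ Kφ : ℝ} (hM : 0 ≤ Mφ) (hK : 0 ≤ Kφ)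
    (hval : ∀ z, |φ z| ≤ Mφ * Real.exp (ϑ * (pinnedChain ω₂ lam β γ).hamiltonian N z))
    (hpair : ∀ z z', ‖z - z'‖ ≤ 1 → |φ z - φ z'| ≤ Kφ * ‖z - z'‖ *
      (Real.exp (θ₁ * (pinnedChain ω₂ lam β γ).hamiltonian N z) + Real.exp (θ₁ * (pinnedChain ω₂ lam β γ).hamiltonian N z')))
    (x y : PhaseSpace N) (hx : E₀ ≤ (pinnedChain ω₂ lam β γ).hamiltonian N x) (hy : E₀ ≤ (pinnedChain ω₂ lam β γ).hamiltonian N y) :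
    |(∫ z, φ z ∂((pinnedChain ω₂ lam β γ).transitionKernel N T T 1 x)) -
        ∫ z, φ z ∂((pinnedChain ω₂ lam β γ).transitionKernel N T T 1 y)| ≤
      ‖x - y‖ * (Real.sqrt (Real.exp (2 * C₀ + (8 * C₀ ^ 2 * T + γ) +
        (4 * C₀ ^ 2 * T + 1 / (4 * T)) * (Real.sqrt ((pinnedChain ω₂ lam β γ).hamiltonian N x) +
          Real.sqrt ((pinnedChain ω₂ lam β γ).hamiltonian N y)))) *
        (Kφ * (Real.sqrt C₃ * (Real.exp (θ₁ * (pinnedChain ω₂ lam β γ).hamiltonian N x -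
            c₃ / 2 * (pinnedChain ω₂ lam β γ).hamiltonian N x ^ (3 / 4 : ℝ)) +
          Real.exp (θ₁ * (pinnedChain ω₂ lam β γ).hamiltonian N y -
            c₃ / 2 * (pinnedChain ω₂ lam β γ).hamiltonian N y ^ (3 / 4 : ℝ)))) +
        Mφ * (Real.exp (2 * ϑ * γ * T) * (Real.exp (ϑ * (pinnedChain ω₂ lam β γ).hamiltonian N x) +
          Real.exp (ϑ * (pinnedChain ω₂ lam β γ).hamiltonian N y))))) := by
  set P := pinnedChain ω₂ lam β γ with hP
  set H := P.hamiltonian N with hH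
  have hθ0 : 0 < θ₁ := hϑ.trans hϑθ
  have hϑT : ϑ < 1 / T := (hϑθ.trans hθT).trans (by rw [div_lt_div_iff₀ (by positivity) hT]; linarith)
  have h2ϑ : 0 < 2 * ϑ := by positivity
  have h2ϑ' : 2 * ϑ < 1 / max T T := by
    rw [max_self, lt_div_iff₀ hT]
    have := hϑθ.trans hθT
    rw [lt_div_iff₀ (by positivity)] at this; linarith
  have hmom : ∀ z : PhaseSpace N, ∫⁻ ω, ENNReal.ofReal (Real.exp (2 * ϑ * H (P.solMap N T T 1 z (pairPath ω)))) ∂wienerPair ≤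
      ENNReal.ofReal (Real.exp (2 * ϑ * γ * (T + T) * (1 : ℝ≥0)) * Real.exp (2 * ϑ * H z)) := fun z =>
    pinnedChain_lintegral_exp_hamiltonian_solMap_le hω hl hβ hγ hN hT hT h2ϑ h2ϑ' 1 z
  have hcpl := lintegral_abs_sub_le_of_coupling hω hl hβ hγ hN hT hC 1 x y (hD 1 (by norm_num) x y) hM hK
    (ϑ := ϑ) (θ₁ := θ₁) hval hpair (mul_nonneg hC₃ (Real.exp_pos _).le) (mul_nonneg hC₃ (Real.exp_pos _).le)
    (by positivity) (by positivity) (hHED x hx) (hHED y hy) (hmom x) (hmom y)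
  have hfin := abs_forecast_sub_le_lintegral hω hl hβ hγ hN hT hφ hϑ hϑT hval 1 x y
  refine hfin.trans ?_
  have hR0 : 0 ≤ ‖x - y‖ * (Real.sqrt (Real.exp (2 * C₀ + (8 * C₀ ^ 2 * T + γ) +
      (4 * C₀ ^ 2 * T + 1 / (4 * T)) * (Real.sqrt (H x) + Real.sqrt (H y)))) *
      (Kφ * (Real.sqrt (C₃ * Real.exp (2 * θ₁ * H x - c₃ * H x ^ (3 / 4 : ℝ))) +
        Real.sqrt (C₃ * Real.exp (2 * θ₁ * H y - c₃ * H y ^ (3 / 4 : ℝ)))) +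
      Mφ * (Real.sqrt (Real.exp (2 * ϑ * γ * (T + T) * (1 : ℝ≥0)) * Real.exp (2 * ϑ * H x)) +
        Real.sqrt (Real.exp (2 * ϑ * γ * (T + T) * (1 : ℝ≥0)) * Real.exp (2 * ϑ * H y))))) := by positivity
  refine ((ENNReal.toReal_mono ENNReal.ofReal_ne_top hcpl).trans_eq (ENNReal.toReal_ofReal hR0)).trans (le_of_eq ?_)
  -- evaluate the square roots
  have hsqB : ∀ z : PhaseSpace N, Real.sqrt (C₃ * Real.exp (2 * θ₁ * H z - c₃ * H z ^ (3 / 4 : ℝ))) =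
      Real.sqrt C₃ * Real.exp (θ₁ * H z - c₃ / 2 * H z ^ (3 / 4 : ℝ)) := fun z => by
    rw [sqrt_mul_exp hC₃]; congr 2; ring
  have hsqD : ∀ z : PhaseSpace N, Real.sqrt (Real.exp (2 * ϑ * γ * (T + T) * (1 : ℝ≥0)) * Real.exp (2 * ϑ * H z)) =
      Real.exp (2 * ϑ * γ * T) * Real.exp (ϑ * H z) := fun z => by
    rw [← Real.exp_add, ← one_mul (Real.exp _), sqrt_mul_exp zero_le_one, Real.sqrt_one, one_mul, ← Real.exp_add]
    congr 1; push_cast; ring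
  rw [hsqB x, hsqB y, hsqD x, hsqD y]
  ring

omit hω hl hβ hγ hN hT in
/-- **The smooth part `φχ_R` through local smoothing.** If the unit-time forecasts of measurable data bounded by
`1` and supported in `{H ≤ R + 1}` are `C_S`-Lipschitz on the shell `{H ≤ E₁}` (stub S4, a hypothesis here),
then for `φ` continuous with `|φ| ≤ M e^{ϑH}` (`ϑ ≥ 0`) and `x, y` in the shell,
`|P_1(φχ)(x) − P_1(φχ)(y)| ≤ M e^{ϑ(R+1)} C_S ‖x − y‖`, `χ = max 0 (min 1 (R + 1 − H))`. [folklore] -/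
theorem smooth_forecast_pair_bound {R E₁ CS : ℝ}
    (hS4 : ∀ F : PhaseSpace N → ℝ, Measurable F → (∀ z, |F z| ≤ 1) →
      (∀ z, R + 1 < (pinnedChain ω₂ lam β γ).hamiltonian N z → F z = 0) →
      ∀ x x' : PhaseSpace N, (pinnedChain ω₂ lam β γ).hamiltonian N x ≤ E₁ →
        (pinnedChain ω₂ lam β γ).hamiltonian N x' ≤ E₁ →
        |(∫ z, F z ∂((pinnedChain ω₂ lam β γ).transitionKernel N T T 1 x)) -
            ∫ z, F z ∂((pinnedChain ω₂ lam β γ).transitionKernel N T T 1 x')| ≤ CS * ‖x - x'‖)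
    {φ : PhaseSpace N → ℝ} (hφ : Continuous φ) {Mφ ϑ : ℝ} (hM : 0 ≤ Mφ) (hϑ : 0 ≤ ϑ)
    (hval : ∀ z, |φ z| ≤ Mφ * Real.exp (ϑ * (pinnedChain ω₂ lam β γ).hamiltonian N z))
    (x y : PhaseSpace N) (hx : (pinnedChain ω₂ lam β γ).hamiltonian N x ≤ E₁) (hy : (pinnedChain ω₂ lam β γ).hamiltonian N y ≤ E₁) :
    |(∫ z, φ z * max 0 (min 1 (R + 1 - (pinnedChain ω₂ lam β γ).hamiltonian N z))
          ∂((pinnedChain ω₂ lam β γ).transitionKernel N T T 1 x)) -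
        ∫ z, φ z * max 0 (min 1 (R + 1 - (pinnedChain ω₂ lam β γ).hamiltonian N z))
          ∂((pinnedChain ω₂ lam β γ).transitionKernel N T T 1 y)| ≤
      Mφ * Real.exp (ϑ * (R + 1)) * CS * ‖x - y‖ := by
  set P := pinnedChain ω₂ lam β γ with hP
  set H := P.hamiltonian N with hH
  have hHc : Continuous H := pinnedChain_continuous_hamiltonian ω₂ lam β γ N
  set c : ℝ := Mφ * Real.exp (ϑ * (R + 1)) with hc
  rcases hM.eq_or_lt with hM0 | hMpos
  · -- `Mφ = 0`: the observable vanishes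
    have hφ0 : ∀ z, φ z = 0 := fun z => by
      have := hval z; rw [← hM0, zero_mul] at this; exact abs_nonpos_iff.1 this
    have hc0 : c = 0 := by rw [hc, ← hM0, zero_mul]
    simp [hφ0, hc0]
  have hcpos : 0 < c := by positivity
  set F : PhaseSpace N → ℝ := fun z => φ z * max 0 (min 1 (R + 1 - H z)) / c with hF
  have hχ0 : ∀ z, 0 ≤ max 0 (min 1 (R + 1 - H z)) := fun z => le_max_left _ _
  have hχ1 : ∀ z, max 0 (min 1 (R + 1 - H z)) ≤ 1 := fun z => max_le zero_le_one (min_le_left _ _)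
  have hFm : Measurable F :=
    ((hφ.mul (continuous_const.max (continuous_const.min (continuous_const.sub hHc)))).div_const _).measurable
  have hF1 : ∀ z, |F z| ≤ 1 := by
    intro z
    simp only [hF]
    rw [abs_div, abs_of_pos hcpos, div_le_one hcpos, abs_mul, abs_of_nonneg (hχ0 z)]
    rcases le_or_gt (H z) (R + 1) with hz | hz
    · calc |φ z| * max 0 (min 1 (R + 1 - H z)) ≤ Mφ * Real.exp (ϑ * H z) * 1 :=
            mul_le_mul (hval z) (hχ1 z) (hχ0 z) (by positivity)
        _ ≤ c := by rw [mul_one, hc]; gcongr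
    · have : max 0 (min 1 (R + 1 - H z)) = 0 := max_eq_left ((min_le_right _ _).trans (by linarith))
      rw [this, mul_zero]; exact hcpos.le
  have hF0 : ∀ z, R + 1 < H z → F z = 0 := fun z hz => by
    have : max 0 (min 1 (R + 1 - H z)) = 0 := max_eq_left ((min_le_right _ _).trans (by linarith))
    simp only [hF, this, mul_zero, zero_div]
  have h := hS4 F hFm hF1 hF0 x y hx hy
  have hrepr : ∀ w : PhaseSpace N, ∫ z, φ z * max 0 (min 1 (R + 1 - H z)) ∂(P.transitionKernel N T T 1 w) =
      c * ∫ z, F z ∂(P.transitionKernel N T T 1 w) := fun w => by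
    simp only [hF]
    rw [integral_div, mul_div_cancel₀ _ hcpos.ne']
  rw [hrepr x, hrepr y, ← mul_sub, abs_mul, abs_of_pos hcpos]
  calc c * |(∫ z, F z ∂(P.transitionKernel N T T 1 x)) - ∫ z, F z ∂(P.transitionKernel N T T 1 y)|
      ≤ c * (CS * ‖x - y‖) := mul_le_mul_of_nonneg_left h hcpos.le
    _ = _ := by rw [hc]; ring

/-- **Splitting the forecast along the cutoff**: `|P_1φ(x) − P_1φ(y)| ≤ |P_1(φχ)(x) − P_1(φχ)(y)| +
|P_1(φ(1−χ))(x) − P_1(φ(1−χ))(y)|` for `φ` continuous of value class `ϑ < 1/T` (all three observables are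
integrable along the flow). [folklore] -/
theorem abs_forecast_sub_le_split {φ : PhaseSpace N → ℝ} (hφ : Continuous φ) {Mφ ϑ : ℝ} (hϑ : 0 < ϑ) (hϑT : ϑ < 1 / T)
    (hval : ∀ z, |φ z| ≤ Mφ * Real.exp (ϑ * (pinnedChain ω₂ lam β γ).hamiltonian N z)) (R : ℝ) (x y : PhaseSpace N) :
    |(∫ z, φ z ∂((pinnedChain ω₂ lam β γ).transitionKernel N T T 1 x)) -
        ∫ z, φ z ∂((pinnedChain ω₂ lam β γ).transitionKernel N T T 1 y)| ≤
      |(∫ z, φ z * max 0 (min 1 (R + 1 - (pinnedChain ω₂ lam β γ).hamiltonian N z))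
          ∂((pinnedChain ω₂ lam β γ).transitionKernel N T T 1 x)) -
        ∫ z, φ z * max 0 (min 1 (R + 1 - (pinnedChain ω₂ lam β γ).hamiltonian N z))
          ∂((pinnedChain ω₂ lam β γ).transitionKernel N T T 1 y)| +
      |(∫ z, φ z * (1 - max 0 (min 1 (R + 1 - (pinnedChain ω₂ lam β γ).hamiltonian N z)))
          ∂((pinnedChain ω₂ lam β γ).transitionKernel N T T 1 x)) -
        ∫ z, φ z * (1 - max 0 (min 1 (R + 1 - (pinnedChain ω₂ lam β γ).hamiltonian N z)))
          ∂((pinnedChain ω₂ lam β γ).transitionKernel N T T 1 y)| := by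
  set P := pinnedChain ω₂ lam β γ with hP
  set H := P.hamiltonian N with hH
  have hHc : Continuous H := pinnedChain_continuous_hamiltonian ω₂ lam β γ N
  set χ : PhaseSpace N → ℝ := fun z => max 0 (min 1 (R + 1 - H z)) with hχ
  have hχc : Continuous χ := continuous_const.max (continuous_const.min (continuous_const.sub hHc))
  have hχ0 : ∀ z, 0 ≤ χ z := fun z => le_max_left _ _
  have hχ1 : ∀ z, χ z ≤ 1 := fun z => max_le zero_le_one (min_le_left _ _)
  have h1c : Continuous fun z => φ z * χ z := hφ.mul hχc
  have h2c : Continuous fun z => φ z * (1 - χ z) := hφ.mul (continuous_const.sub hχc)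
  have hval1 : ∀ z, |φ z * χ z| ≤ Mφ * Real.exp (ϑ * H z) := fun z => by
    rw [abs_mul, abs_of_nonneg (hχ0 z)]
    calc |φ z| * χ z ≤ |φ z| * 1 := by gcongr; exact hχ1 z
      _ ≤ _ := by rw [mul_one]; exact hval z
  have hval2 : ∀ z, |φ z * (1 - χ z)| ≤ Mφ * Real.exp (ϑ * H z) := fun z => by
    rw [abs_mul, abs_of_nonneg (sub_nonneg.2 (hχ1 z))]
    calc |φ z| * (1 - χ z) ≤ |φ z| * 1 := by gcongr; linarith [hχ0 z]
      _ ≤ _ := by rw [mul_one]; exact hval z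
  -- decompose the integrals along the flow representation
  have hdec : ∀ w : PhaseSpace N, ∫ z, φ z ∂(P.transitionKernel N T T 1 w) =
      (∫ z, φ z * χ z ∂(P.transitionKernel N T T 1 w)) + ∫ z, φ z * (1 - χ z) ∂(P.transitionKernel N T T 1 w) := by
    intro w
    rw [pinnedChain_integral_transitionKernel hω hl hβ hγ N T T 1 w (g := φ) hφ.aestronglyMeasurable,
      pinnedChain_integral_transitionKernel hω hl hβ hγ N T T 1 w (g := fun z => φ z * χ z) h1c.aestronglyMeasurable,
      pinnedChain_integral_transitionKernel hω hl hβ hγ N T T 1 w (g := fun z => φ z * (1 - χ z)) h2c.aestronglyMeasurable,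
      ← integral_add (integrable_comp_solMap_of_abs_le hω hl hβ hγ hN hT h1c hϑ hϑT hval1 1 w)
        (integrable_comp_solMap_of_abs_le hω hl hβ hγ hN hT h2c hϑ hϑT hval2 1 w)]
    refine integral_congr_ae (Eventually.of_forall fun ω => ?_)
    simp only
    ring
  rw [hdec x, hdec y]
  calc |(∫ z, φ z * χ z ∂(P.transitionKernel N T T 1 x)) + (∫ z, φ z * (1 - χ z) ∂(P.transitionKernel N T T 1 x)) -
        ((∫ z, φ z * χ z ∂(P.transitionKernel N T T 1 y)) + ∫ z, φ z * (1 - χ z) ∂(P.transitionKernel N T T 1 y))|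
      = |((∫ z, φ z * χ z ∂(P.transitionKernel N T T 1 x)) - ∫ z, φ z * χ z ∂(P.transitionKernel N T T 1 y)) +
        ((∫ z, φ z * (1 - χ z) ∂(P.transitionKernel N T T 1 x)) - ∫ z, φ z * (1 - χ z) ∂(P.transitionKernel N T T 1 y))| := by
        ring_nf
    _ ≤ _ := abs_add_le _ _

end Flow

/-- **Registered form of this file's principal inequality** (`stub_lasotaYorke_aux4`, closed statement of
`one_add_sq_le_exp'`). [folklore] -/
theorem stub_lasotaYorke_aux4 :
    ∀ (h ϑ : ℝ), 0 ≤ h → 0 < ϑ → (1 + h) ^ 2 ≤ 2 * (1 + 4 / ϑ ^ 2) * Real.exp (ϑ * h) :=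
  fun _ _ hh hϑ => one_add_sq_le_exp' hh hϑ

end Summit.AtomisticToContinuum.FouriersLaw.Cruxes.StaticKubo.Birth.Stubs

end
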